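import Mathlib
import HarnessLib
import Literature.Probability.MarkovChains.RelaxationTimeVarianceDecay
import Literature.Probability.ImportanceSampling.OptimalImportanceDistribution

/-!
# ChiSqContraction — relaxation layers that contract the `χ²`-distance to their own target: the
# kernel-side toolkit for the general-layer lag law (composition, reversible layers via the
# Levin–Peres variance decay `λ⋆`, the Cauchy–Schwarz lag bound, the change of reference law)

HONEST FRAMING: exact (Metropolis-corrected) sampling algorithms for lattice gauge theory;
figures of merit are autocorrelation/cost numbers at stated couplings and volumes; no
continuum-physics claim.

Venture `LatticeQCDFlow` (cell pub-lqcd), topic `Scaling`; FANOUT row 19 (`su2-snf`, GEN-5).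
OUR WORK (elementary finite sums), nothing here is cited as a fact.  The vocabulary is the
Literature's: finite `X`, ROW kernels `K : X → X → ℝ`, `stepLaw K μ = μK`, `lawAt`, `kernelAt`,
`IsRowStochastic`, `DetailedBalance`, `lawMean`, `lawVariance`, `lambdaStar K = λ⋆`
(`Literature/Probability/MarkovChains/…`, Levin–Peres–Wilmer conventions) and the Pearson `χ²`
divergence `chiSqDiv μ π = Σ π (μ/π − 1)² = Σ (μ − π)²/π` of
`Literature/Probability/ImportanceSampling/OptimalImportanceDistribution` (Agapiou et al. 2017, as
printed).  Purpose: the lag law of row 8 (`Exactness/LazyRelaxationLagLaw.lean`: what an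
UNDER-relaxed switching protocol dissipates above the quasi-static floor) is exact for LAZY layers
`ε·I + (1 − ε)·Π` only ("the production heat-bath / over-relaxation kernels are not claimed",
`Exactness/LazyRelaxationESS`).  The general-layer version (`Scaling/GeneralLayerLagLaw.lean`,
this seat) needs exactly one property of a layer — that it CONTRACTS the `χ²`-distance to the law it
targets — and this file isolates that property and the four elementary inequalities that drive the
law:

* `ChiSqContracts K π ρ` — `χ²(μK ‖ π) ≤ ρ² χ²(μ ‖ π)` for every unit-mass `μ` (signed `μ` allowed,
  so for a `π`-stationary `K` the best `ρ` is the `L²(π)` operator norm of `K` on mean-zero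
  functions: the second-largest singular value; `λ⋆` for a reversible `K`);
  `ChiSqContracts.mono`; the two endpoints `chiSqContracts_perfect` (`K = Π`, `ρ = 0`) and
  `chiSqContracts_id` (`K = I`, `ρ = 1`);
* **`ChiSqContracts.comp` / `.chiSqDiv_lawAt_le` / `.pow`** — MORE RELAXATION PER STEP MULTIPLIES THE
  COEFFICIENTS: `K₁` then `K₂` contracts with `ρ₁ρ₂`, `m` sweeps of `K` with `ρ^m`;
* **`chiSqContracts_of_lawVariance_le`** — for a `π`-REVERSIBLE `K` the function-side statement
  `Var_π(Kf) ≤ ρ² Var_π(f)` implies `ChiSqContracts K π ρ` (the density of `μK` is `K(dμ/dπ)` by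
  detailed balance), and **`chiSqContracts_of_reversible`** — by the Literature's PROVED variance
  decay `Var_π(Pf) ≤ λ⋆² Var_π(f)` (Levin–Peres–Wilmer eq. (12.8), `LevinPeres2017_eq_12_8` at
  `t = 1`) EVERY reversible irreducible layer contracts with `ρ = λ⋆ = 1 − γ⋆ = 1 − 1/t_rel`:
  the hypothesis of the general-layer lag law is DISCHARGED by the absolute spectral gap, with no
  monotonicity / laziness / positivity-of-correlations assumption;
* `abs_sum_mul_sub_sum_mul_le` — THE LAG BOUND (Cauchy–Schwarz):
  `|E_μ f − E_π f| ≤ √χ²(μ ‖ π) · √Var_π(f)`;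
* `chiSqDiv_le_mul_of_le`, `sqrt_chiSqDiv_le_add` — CHANGE OF REFERENCE LAW: if `π ≤ R·π'`
  pointwise then `√χ²(μ ‖ π') ≤ √R·√χ²(μ ‖ π) + √χ²(π ‖ π')` (Minkowski in `L²(1/π')`), and
  `le_exp_mul_of_abs_log_sub_le` — two probability vectors whose log-ratio oscillates by at most
  `M` satisfy `π ≤ e^{M}·π'`; `sqrt_chiSqDiv_step_le` packages one protocol step
  (switch the reference, then relax): `√χ²(μK ‖ π') ≤ ρ(√R·√χ²(μ ‖ π) + √χ²(π ‖ π'))`.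

NOT CLAIMED: any value of `ρ` for a lattice heat-bath / over-relaxation / HMC layer; that `λ⋆` is
attained; non-reversible discharges (the second singular value is not typed in the tree);
anything about path-space ESS (this is the MEAN-work side of the dictionary only).
-/

namespace Summit.Ventures.LatticeQCDFlow.Scaling

open Finset
open Literature.Probability.MarkovChains
open Literature.Probability.ImportanceSampling (chiSqDiv chiSqDiv_def chiSqDiv_eq_sum_sq_div)

variable {X : Type*} [Fintype X]

/-! ## The `χ²`-distance to a positive law: sign, zero, change of reference -/

/-- `χ²(μ ‖ π) ≥ 0` for a non-negative reference law. -/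
theorem chiSqDiv_nonneg_of_nonneg {π : X → ℝ} (hπ : ∀ x, 0 ≤ π x) (μ : X → ℝ) :
    0 ≤ chiSqDiv μ π := by
  rw [chiSqDiv_def]
  exact sum_nonneg fun x _ => mul_nonneg (hπ x) (sq_nonneg _)

/-- `χ²(π ‖ π) = 0`. -/
theorem chiSqDiv_self_eq_zero (π : X → ℝ) : chiSqDiv π π = 0 := by
  rw [chiSqDiv_eq_sum_sq_div]
  simp

/-- **Change of reference law (squared form).**  If `π ≤ R·π'` pointwise (`π, π' > 0`) then for
every signed `v`, `Σ v²/π' ≥ …` reads `Σ (μ − π)²/π' ≤ R·Σ (μ − π)²/π`, i.e. the `π`-centred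
Pearson sum measured against `π'` is at most `R` times `χ²(μ ‖ π)`. -/
theorem sum_sq_div_le_mul_chiSqDiv {μ π π' : X → ℝ} (hπ : ∀ x, 0 < π x) (hπ' : ∀ x, 0 < π' x)
    {R : ℝ} (hR : ∀ x, π x ≤ R * π' x) :
    ∑ x, (μ x - π x) ^ 2 / π' x ≤ R * chiSqDiv μ π := by
  rw [chiSqDiv_eq_sum_sq_div, mul_sum]
  refine sum_le_sum fun x _ => ?_
  have h1 : (μ x - π x) ^ 2 / π' x = ((μ x - π x) ^ 2 / π x) * (π x / π' x) := by
    rw [div_mul_div_comm, mul_comm (π x) (π' x), mul_div_mul_right _ _ (hπ x).ne']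
  rw [h1, mul_comm R]
  exact mul_le_mul_of_nonneg_left ((div_le_iff₀ (hπ' x)).mpr (hR x))
    (div_nonneg (sq_nonneg _) (hπ x).le)

/-- Cauchy–Schwarz in `L²(1/π')`: `Σ u v/π' ≤ √(Σ u²/π') · √(Σ v²/π')`. -/
theorem sum_mul_div_le_sqrt_mul_sqrt {π' : X → ℝ} (hπ' : ∀ x, 0 < π' x) (u v : X → ℝ) :
    ∑ x, u x * v x / π' x
      ≤ Real.sqrt (∑ x, u x ^ 2 / π' x) * Real.sqrt (∑ x, v x ^ 2 / π' x) := by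
  have hcs := Finset.sum_mul_sq_le_sq_mul_sq univ (fun x => u x / Real.sqrt (π' x))
    (fun x => v x / Real.sqrt (π' x))
  have hs : ∀ x, Real.sqrt (π' x) ^ 2 = π' x := fun x => Real.sq_sqrt (hπ' x).le
  have e1 : ∀ x, u x / Real.sqrt (π' x) * (v x / Real.sqrt (π' x)) = u x * v x / π' x := by
    intro x; rw [div_mul_div_comm, ← sq, hs x]
  have e2 : ∀ w : X → ℝ, ∀ x, (w x / Real.sqrt (π' x)) ^ 2 = w x ^ 2 / π' x := by
    intro w x; rw [div_pow, hs x]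
  simp_rw [e1, e2] at hcs
  have hA : 0 ≤ ∑ x, u x ^ 2 / π' x := sum_nonneg fun x _ => div_nonneg (sq_nonneg _) (hπ' x).le
  have hB : 0 ≤ ∑ x, v x ^ 2 / π' x := sum_nonneg fun x _ => div_nonneg (sq_nonneg _) (hπ' x).le
  calc ∑ x, u x * v x / π' x ≤ |∑ x, u x * v x / π' x| := le_abs_self _
    _ ≤ Real.sqrt ((∑ x, u x ^ 2 / π' x) * ∑ x, v x ^ 2 / π' x) := Real.abs_le_sqrt hcs
    _ = Real.sqrt (∑ x, u x ^ 2 / π' x) * Real.sqrt (∑ x, v x ^ 2 / π' x) := Real.sqrt_mul hA _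

/-- Minkowski in `L²(1/π')`: `√(Σ (u+v)²/π') ≤ √(Σ u²/π') + √(Σ v²/π')`. -/
theorem sqrt_sum_add_sq_div_le {π' : X → ℝ} (hπ' : ∀ x, 0 < π' x) (u v : X → ℝ) :
    Real.sqrt (∑ x, (u x + v x) ^ 2 / π' x)
      ≤ Real.sqrt (∑ x, u x ^ 2 / π' x) + Real.sqrt (∑ x, v x ^ 2 / π' x) := by
  set A := ∑ x, u x ^ 2 / π' x with hA
  set B := ∑ x, v x ^ 2 / π' x with hB
  have hA0 : 0 ≤ A := sum_nonneg fun x _ => div_nonneg (sq_nonneg _) (hπ' x).le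
  have hB0 : 0 ≤ B := sum_nonneg fun x _ => div_nonneg (sq_nonneg _) (hπ' x).le
  have hcs := sum_mul_div_le_sqrt_mul_sqrt hπ' u v
  have hexp : ∑ x, (u x + v x) ^ 2 / π' x = A + 2 * ∑ x, u x * v x / π' x + B := by
    rw [hA, hB, mul_sum, ← sum_add_distrib, ← sum_add_distrib]
    refine sum_congr rfl fun x _ => ?_
    field_simp
    ring
  rw [hexp]
  have hsum0 : 0 ≤ Real.sqrt A + Real.sqrt B := add_nonneg (Real.sqrt_nonneg _) (Real.sqrt_nonneg _)
  refine (Real.sqrt_le_left hsum0).mpr ?_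
  nlinarith [Real.sq_sqrt hA0, Real.sq_sqrt hB0, hcs]

/-- **Change of reference law.**  If `π ≤ R·π'` pointwise (`π, π' > 0`, `R ≥ 0`), then
`√χ²(μ ‖ π') ≤ √R · √χ²(μ ‖ π) + √χ²(π ‖ π')` (Minkowski: `μ − π' = (μ − π) + (π − π')`). -/
theorem sqrt_chiSqDiv_le_add {μ π π' : X → ℝ} (hπ : ∀ x, 0 < π x) (hπ' : ∀ x, 0 < π' x)
    {R : ℝ} (hR0 : 0 ≤ R) (hR : ∀ x, π x ≤ R * π' x) :
    Real.sqrt (chiSqDiv μ π')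
      ≤ Real.sqrt R * Real.sqrt (chiSqDiv μ π) + Real.sqrt (chiSqDiv π π') := by
  have hmink := sqrt_sum_add_sq_div_le hπ' (fun x => μ x - π x) (fun x => π x - π' x)
  have e : ∀ x, (μ x - π x + (π x - π' x)) ^ 2 / π' x = (μ x - π' x) ^ 2 / π' x := by
    intro x; ring
  simp_rw [e] at hmink
  rw [chiSqDiv_eq_sum_sq_div μ π', chiSqDiv_eq_sum_sq_div π π']
  refine hmink.trans (add_le_add ?_ le_rfl)
  rw [← Real.sqrt_mul hR0]
  exact Real.sqrt_le_sqrt (sum_sq_div_le_mul_chiSqDiv hπ hπ' hR)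

/-- **Two probability vectors whose log-ratio oscillates by at most `M` are comparable:**
`π ≤ e^{M}·π'`.  (Some `y` has `π y ≤ π' y` since both sum to one; then
`π x/π' x ≤ e^{M} π y/π' y ≤ e^{M}`.) -/
theorem le_exp_mul_of_abs_log_sub_le [Nonempty X] {π π' : X → ℝ} (hπ : ∀ x, 0 < π x)
    (hπ' : ∀ x, 0 < π' x) (hπ1 : ∑ x, π x = 1) (hπ'1 : ∑ x, π' x = 1) {M : ℝ}
    (hM : ∀ x y, |Real.log (π x / π' x) - Real.log (π y / π' y)| ≤ M) (x : X) :
    π x ≤ Real.exp M * π' x := by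
  obtain ⟨y, -, hy⟩ := Finset.exists_le_of_sum_le (univ_nonempty (α := X))
    (show ∑ z, π z ≤ ∑ z, π' z by rw [hπ1, hπ'1])
  have hy' : Real.log (π y / π' y) ≤ 0 :=
    Real.log_nonpos (div_pos (hπ y) (hπ' y)).le ((div_le_one (hπ' y)).mpr hy)
  have hx : Real.log (π x / π' x) ≤ M := by
    have h := (abs_le.mp (hM x y)).2
    linarith
  have hx' : π x / π' x ≤ Real.exp M := by
    rw [← Real.exp_log (div_pos (hπ x) (hπ' x))]
    exact Real.exp_le_exp.mpr hx
  rwa [div_le_iff₀ (hπ' x)] at hx'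

/-! ## The lag bound: `|E_μ f − E_π f| ≤ √χ²(μ ‖ π) · σ_π(f)` -/

/-- `Var_π(f)` of the Literature (`lawVariance`) is non-negative for `π ≥ 0`. -/
theorem lawVariance_nonneg_of_nonneg {π : X → ℝ} (hπ : ∀ x, 0 ≤ π x) (f : X → ℝ) :
    0 ≤ lawVariance π f := by
  unfold lawVariance
  exact sum_nonneg fun x _ => mul_nonneg (hπ x) (sq_nonneg _)

/-- **THE LAG BOUND (Cauchy–Schwarz).**  For unit-mass `μ` and a positive probability vector `π`:
`|Σ μ f − Σ π f| ≤ √χ²(μ ‖ π) · √Var_π(f)` — a law that is `χ²`-close to `π` gives every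
observable a mean close to its `π`-mean, at the scale of the observable's own fluctuation. -/
theorem abs_sum_mul_sub_sum_mul_le {μ π : X → ℝ} (hπ : ∀ x, 0 < π x) (hμ1 : ∑ x, μ x = 1)
    (hπ1 : ∑ x, π x = 1) (f : X → ℝ) :
    |∑ x, μ x * f x - ∑ x, π x * f x|
      ≤ Real.sqrt (chiSqDiv μ π) * Real.sqrt (lawVariance π f) := by
  set m := lawMean π f with hm
  have hcen : ∑ x, μ x * f x - ∑ x, π x * f x = ∑ x, (μ x - π x) * (π x * (f x - m)) / π x := by
    have h0 : ∑ x, (μ x - π x) * m = 0 := by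
      rw [← sum_mul, sum_sub_distrib, hμ1, hπ1, sub_self, zero_mul]
    have e : ∀ x, (μ x - π x) * (π x * (f x - m)) / π x
        = (μ x * f x - π x * f x) - (μ x - π x) * m := by
      intro x
      rw [mul_div_assoc, mul_div_cancel_left₀ _ (hπ x).ne']
      ring
    calc ∑ x, μ x * f x - ∑ x, π x * f x
        = ∑ x, (μ x * f x - π x * f x) - ∑ x, (μ x - π x) * m := by
          rw [h0, sub_zero, sum_sub_distrib]
      _ = ∑ x, ((μ x * f x - π x * f x) - (μ x - π x) * m) := by rw [← sum_sub_distrib]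
      _ = ∑ x, (μ x - π x) * (π x * (f x - m)) / π x := sum_congr rfl fun x _ => (e x).symm
  have hcs := sum_mul_div_le_sqrt_mul_sqrt hπ (fun x => μ x - π x) (fun x => π x * (f x - m))
  have hcs' := sum_mul_div_le_sqrt_mul_sqrt hπ (fun x => -(μ x - π x)) (fun x => π x * (f x - m))
  have eA : ∑ x, (μ x - π x) ^ 2 / π x = chiSqDiv μ π := (chiSqDiv_eq_sum_sq_div μ π).symm
  have eA' : ∑ x, (-(μ x - π x)) ^ 2 / π x = chiSqDiv μ π := by
    rw [chiSqDiv_eq_sum_sq_div]; exact sum_congr rfl fun x _ => by rw [neg_sq]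
  have eB : ∑ x, (π x * (f x - m)) ^ 2 / π x = lawVariance π f := by
    unfold lawVariance
    refine sum_congr rfl fun x _ => ?_
    rw [hm, mul_pow, sq, mul_assoc, mul_div_assoc, mul_div_cancel_left₀ _ (hπ x).ne']
  have eS' : ∑ x, -(μ x - π x) * (π x * (f x - m)) / π x = -(∑ x, μ x * f x - ∑ x, π x * f x) := by
    rw [hcen, ← sum_neg_distrib]; exact sum_congr rfl fun x _ => by ring
  rw [eA, eB, ← hcen] at hcs
  rw [eA', eB, eS'] at hcs'
  exact abs_le.mpr ⟨by linarith, hcs⟩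

/-! ## Layers that contract `χ²` towards their target -/

/-- **`χ²`-contraction of a layer towards a law.**  `K` contracts the Pearson `χ²`-distance to `π`
with coefficient `ρ`: `χ²(μK ‖ π) ≤ ρ²·χ²(μ ‖ π)` for every unit-mass (possibly signed) `μ`.  For a
`π`-stationary `K` the optimal `ρ` is the operator norm of `K` on mean-zero functions in `L²(π)`
(second singular value; `λ⋆` when `K` is reversible, `chiSqContracts_of_reversible`); the
finite-state, fixed-reference form of the `χ²` contraction / strong-data-processing coefficient.
[folklore] -/
def ChiSqContracts (K : X → X → ℝ) (π : X → ℝ) (ρ : ℝ) : Prop :=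
  ∀ μ : X → ℝ, ∑ x, μ x = 1 → chiSqDiv (stepLaw K μ) π ≤ ρ ^ 2 * chiSqDiv μ π

/-- A larger coefficient is a weaker statement (`π ≥ 0`, `0 ≤ ρ ≤ ρ'`). -/
theorem ChiSqContracts.mono {K : X → X → ℝ} {π : X → ℝ} {ρ ρ' : ℝ} (h : ChiSqContracts K π ρ)
    (hπ : ∀ x, 0 ≤ π x) (hρ : 0 ≤ ρ) (hρρ' : ρ ≤ ρ') : ChiSqContracts K π ρ' := fun μ hμ =>
  (h μ hμ).trans (mul_le_mul_of_nonneg_right (pow_le_pow_left₀ hρ hρρ' 2)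
    (chiSqDiv_nonneg_of_nonneg hπ μ))

/-- The perfect-relaxation layer `Π` (resample from `π`) maps every unit-mass law to `π`. -/
theorem stepLaw_perfect (π : X → ℝ) {μ : X → ℝ} (hμ1 : ∑ x, μ x = 1) :
    stepLaw (fun _ y => π y) μ = π := by
  funext y
  unfold stepLaw
  rw [← sum_mul, hμ1, one_mul]

/-- Endpoint `ρ = 0`: PERFECT RELAXATION contracts `χ²` to zero. -/
theorem chiSqContracts_perfect (π : X → ℝ) : ChiSqContracts (fun _ y => π y) π 0 := by
  intro μ hμ
  rw [stepLaw_perfect π hμ, chiSqDiv_self_eq_zero]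
  simp

/-- Endpoint `ρ = 1`: NO RELAXATION (the identity layer) contracts nothing and expands nothing. -/
theorem chiSqContracts_id [DecidableEq X] (π : X → ℝ) :
    ChiSqContracts (fun x y => if y = x then 1 else 0) π 1 := by
  intro μ _
  have h : stepLaw (fun x y => if y = x then (1:ℝ) else 0) μ = μ := by
    funext y
    unfold stepLaw
    simp only [mul_ite, mul_one, mul_zero, Finset.sum_ite_eq, Finset.mem_univ, if_true]
  rw [h, one_pow, one_mul]

/-- Unit row sums preserve the mass of a law. -/
theorem sum_stepLaw_of_rowsum {K : X → X → ℝ} (hK : ∀ x, ∑ y, K x y = 1) (μ : X → ℝ) :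
    ∑ y, stepLaw K μ y = ∑ x, μ x := by
  unfold stepLaw
  rw [sum_comm]
  exact sum_congr rfl fun x _ => by rw [← mul_sum, hK x, mul_one]

/-- Doing `K₁` then `K₂` is the layer `(K₁K₂)(x,z) = Σ_y K₁(x,y) K₂(y,z)`:
`μ(K₁K₂) = (μK₁)K₂`. -/
theorem stepLaw_comp (K₁ K₂ : X → X → ℝ) (μ : X → ℝ) :
    stepLaw (fun x z => ∑ y, K₁ x y * K₂ y z) μ = stepLaw K₂ (stepLaw K₁ μ) := by
  funext z
  unfold stepLaw
  simp_rw [mul_sum, sum_mul]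
  rw [sum_comm]
  exact sum_congr rfl fun y _ => sum_congr rfl fun x _ => by ring

/-- **Composition multiplies the coefficients**: `K₁` (unit row sums) contracting with `ρ₁` followed
by `K₂` contracting with `ρ₂`, both towards the same `π`, contracts with `ρ₁ρ₂` — more relaxation
sweeps per protocol step shrink the coefficient geometrically. -/
theorem ChiSqContracts.comp {K₁ K₂ : X → X → ℝ} {π : X → ℝ} {ρ₁ ρ₂ : ℝ}
    (h₁ : ChiSqContracts K₁ π ρ₁) (h₂ : ChiSqContracts K₂ π ρ₂) (hK₁ : ∀ x, ∑ y, K₁ x y = 1) :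
    ChiSqContracts (fun x z => ∑ y, K₁ x y * K₂ y z) π (ρ₁ * ρ₂) := by
  intro μ hμ
  rw [stepLaw_comp]
  have hm : ∑ y, stepLaw K₁ μ y = 1 := by rw [sum_stepLaw_of_rowsum hK₁, hμ]
  calc chiSqDiv (stepLaw K₂ (stepLaw K₁ μ)) π
      ≤ ρ₂ ^ 2 * chiSqDiv (stepLaw K₁ μ) π := h₂ _ hm
    _ ≤ ρ₂ ^ 2 * (ρ₁ ^ 2 * chiSqDiv μ π) := mul_le_mul_of_nonneg_left (h₁ μ hμ) (sq_nonneg _)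
    _ = (ρ₁ * ρ₂) ^ 2 * chiSqDiv μ π := by ring

/-- **`m` sweeps contract with `ρ^m`** (law form): `χ²(μK^m ‖ π) ≤ ρ^{2m} χ²(μ ‖ π)`. -/
theorem ChiSqContracts.chiSqDiv_lawAt_le {K : X → X → ℝ} {π : X → ℝ} {ρ : ℝ} (h : ChiSqContracts K π ρ)
    (hK : IsRowStochastic K) {μ : X → ℝ} (hμ : ∑ x, μ x = 1) :
    ∀ m : ℕ, chiSqDiv (lawAt K μ m) π ≤ (ρ ^ m) ^ 2 * chiSqDiv μ π
  | 0 => by simp [lawAt_zero]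
  | m + 1 => by
      have ih := ChiSqContracts.chiSqDiv_lawAt_le h hK hμ m
      have hmass : ∑ y, lawAt K μ m y = 1 := by rw [sum_lawAt hK, hμ]
      rw [lawAt_succ]
      calc chiSqDiv (stepLaw K (lawAt K μ m)) π
          ≤ ρ ^ 2 * chiSqDiv (lawAt K μ m) π := h _ hmass
        _ ≤ ρ ^ 2 * ((ρ ^ m) ^ 2 * chiSqDiv μ π) := mul_le_mul_of_nonneg_left ih (sq_nonneg _)
        _ = (ρ ^ (m + 1)) ^ 2 * chiSqDiv μ π := by ring

/-- **`m` sweeps contract with `ρ^m`** (kernel form, `kernelAt K m = K^m`). -/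
theorem ChiSqContracts.pow [DecidableEq X] {K : X → X → ℝ} {π : X → ℝ} {ρ : ℝ}
    (h : ChiSqContracts K π ρ) (hK : IsRowStochastic K) (m : ℕ) :
    ChiSqContracts (kernelAt K m) π (ρ ^ m) := fun μ hμ => by
  rw [← lawAt_eq_stepLaw_kernelAt]
  exact h.chiSqDiv_lawAt_le hK hμ m

/-! ## Reversible layers: variance contraction on functions ⇒ `χ²`-contraction on laws -/

/-- **Detailed balance turns the function-side contraction into the law-side one.**  If `K` has
unit row sums, is reversible with respect to the positive `π`, and contracts the `π`-variance of
functions, `Var_π(Kf) ≤ ρ² Var_π(f)` (`(Kf)(x) = Σ_y K(x,y) f(y)`), then `ChiSqContracts K π ρ`: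
the density of `μK` with respect to `π` is `K(dμ/dπ)`, whose `π`-mean is `1`, so
`χ²(μK ‖ π) = Var_π(K h) ≤ ρ² Var_π(h) = ρ² χ²(μ ‖ π)` with `h = dμ/dπ`. -/
theorem chiSqContracts_of_lawVariance_le {K : X → X → ℝ} {π : X → ℝ} {ρ : ℝ}
    (hπ : ∀ x, 0 < π x) (hK1 : ∀ x, ∑ y, K x y = 1) (hDB : DetailedBalance π K)
    (hvar : ∀ f : X → ℝ, lawVariance π (fun x => ∑ y, K x y * f y) ≤ ρ ^ 2 * lawVariance π f) :
    ChiSqContracts K π ρ := by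
  intro μ hμ
  obtain ⟨h, hμπ⟩ : ∃ h : X → ℝ, ∀ x, μ x = π x * h x :=
    ⟨fun x => μ x / π x, fun x => by rw [mul_div_cancel₀ _ (hπ x).ne']⟩
  -- the step law is `π · (K h)`
  have hstep : ∀ y, stepLaw K μ y = π y * ∑ x, K y x * h x := by
    intro y
    unfold stepLaw
    rw [mul_sum]
    refine sum_congr rfl fun x _ => ?_
    rw [hμπ x, show π x * h x * K x y = (π x * K x y) * h x by ring, hDB x y]
    ring
  -- `E_π h = Σ μ = 1` and `E_π (K h) = 1`
  have hmean_h : lawMean π h = 1 := by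
    unfold lawMean
    rw [← hμ]
    exact sum_congr rfl fun x _ => (hμπ x).symm
  have hmean_Kh : lawMean π (fun y => ∑ x, K y x * h x) = 1 := by
    unfold lawMean
    calc ∑ y, π y * ∑ x, K y x * h x
        = ∑ y, ∑ x, π x * K x y * h x := by
          refine sum_congr rfl fun y _ => ?_
          rw [mul_sum]
          refine sum_congr rfl fun x _ => ?_
          rw [← mul_assoc, ← hDB x y]
      _ = ∑ x, π x * h x * ∑ y, K x y := by
          rw [sum_comm]
          refine sum_congr rfl fun x _ => ?_
          rw [mul_sum]
          exact sum_congr rfl fun y _ => by ring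
      _ = ∑ x, π x * h x := sum_congr rfl fun x _ => by rw [hK1 x, mul_one]
      _ = 1 := by rw [← hμ]; exact sum_congr rfl fun x _ => (hμπ x).symm
  have hchi_step : chiSqDiv (stepLaw K μ) π = lawVariance π (fun y => ∑ x, K y x * h x) := by
    unfold lawVariance
    rw [hmean_Kh, chiSqDiv_def]
    refine sum_congr rfl fun y _ => ?_
    rw [hstep y, mul_div_cancel_left₀ _ (hπ y).ne']
  have hchi_μ : chiSqDiv μ π = lawVariance π h := by
    unfold lawVariance
    rw [hmean_h, chiSqDiv_def]
    refine sum_congr rfl fun x _ => ?_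
    rw [hμπ x, mul_div_cancel_left₀ _ (hπ x).ne']
  rw [hchi_step, hchi_μ]
  exact hvar h

/-- The one-step kernel is the kernel: `kernelAt K 1 = K`. -/
theorem kernelAt_one_eq [DecidableEq X] (K : X → X → ℝ) (x y : X) : kernelAt K 1 x y = K x y := by
  show lawAt K (Pi.single x 1) 1 y = K x y
  rw [lawAt_succ, lawAt_zero]
  unfold stepLaw
  simp only [Pi.single_apply, ite_mul, one_mul, zero_mul, Finset.sum_ite_eq', Finset.mem_univ,
    if_true]

/-- **EVERY REVERSIBLE IRREDUCIBLE LAYER CONTRACTS `χ²` WITH `ρ = λ⋆ = 1 − γ⋆ = 1 − 1/t_rel`**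
(the hypothesis of the general-layer lag law, DISCHARGED by the absolute spectral gap): by the
Literature's proved variance decay `Var_π(Pf) ≤ (1 − γ⋆)² Var_π(f)` (Levin–Peres–Wilmer (12.8),
`LevinPeres2017_eq_12_8`, at `t = 1`) and `chiSqContracts_of_lawVariance_le`. -/
theorem chiSqContracts_of_reversible [DecidableEq X] {K : X → X → ℝ} {π : X → ℝ}
    (hπ : ∀ x, 0 < π x) (hπ1 : ∑ x, π x = 1) (hK : IsRowStochastic K) (hDB : DetailedBalance π K)
    (hirr : IsIrreducible K) : ChiSqContracts K π (lambdaStar K) := by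
  refine chiSqContracts_of_lawVariance_le hπ hK.2 hDB fun f => ?_
  have h := LevinPeres2017_eq_12_8 hπ hπ1 hK hDB hirr f 1
  simp_rw [kernelAt_one_eq, mul_one] at h
  have e : 1 - absSpectralGap K = lambdaStar K := by unfold absSpectralGap; ring
  rw [e] at h
  exact h

/-! ## One protocol step: switch the reference law, then relax -/

/-- **One step of a switching protocol, on the `χ²` scale.**  A unit-mass `μ` at `χ²`-distance
`χ²(μ ‖ π)` from the OLD target, a NEW target `π'` with `π ≤ R·π'`, and a layer `K` that contracts
`χ²` towards `π'` with `ρ ≥ 0`: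
`√χ²(μK ‖ π') ≤ ρ·(√R·√χ²(μ ‖ π) + √χ²(π ‖ π'))`. -/
theorem sqrt_chiSqDiv_step_le {K : X → X → ℝ} {μ π π' : X → ℝ} {ρ R : ℝ}
    (hK : ChiSqContracts K π' ρ) (hρ : 0 ≤ ρ) (hμ1 : ∑ x, μ x = 1) (hπ : ∀ x, 0 < π x)
    (hπ' : ∀ x, 0 < π' x) (hR0 : 0 ≤ R) (hR : ∀ x, π x ≤ R * π' x) :
    Real.sqrt (chiSqDiv (stepLaw K μ) π')
      ≤ ρ * (Real.sqrt R * Real.sqrt (chiSqDiv μ π) + Real.sqrt (chiSqDiv π π')) := by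
  have h1 : Real.sqrt (chiSqDiv (stepLaw K μ) π') ≤ ρ * Real.sqrt (chiSqDiv μ π') := by
    rw [← Real.sqrt_sq hρ, ← Real.sqrt_mul (sq_nonneg ρ)]
    exact Real.sqrt_le_sqrt (hK μ hμ1)
  exact h1.trans (mul_le_mul_of_nonneg_left (sqrt_chiSqDiv_le_add hπ hπ' hR0 hR) hρ)

end Summit.Ventures.LatticeQCDFlow.Scaling
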